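import Summits.Langlands.Langlands.Theses.TorsionAvatarReduction

/-!
# Route TorsionAvatarReduction — Assembly

The assembly item (stmt-Langlands-28547) of the child route `TorsionAvatarReduction` (decomp-langlands lens-4 gen 17; refines the declared
residual REG = `RegularAvatarReduction.RegularNonLiftableAutomorphy`, stmt-Langlands-28274) for the Langlands summit:
`TorsionAvatarAutomorphy → AvatarlessResidueAutomorphy → RegularResidueFrame → Langlands`.

This is literally the type of the route file's sorry-free deciding theorem `Summit.Langlands.Langlands.Theses.TorsionAvatarReduction.closes`
(FRAME⁗ reduces `Langlands` to REG; one excluded middle on the torsion-avatar dial dispatches to TA or AL).  Nothing here proves `Langlands`: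
the assembly records only that the three ledger items of the route, taken together, imply the summit statement.
-/

set_option linter.dupNamespace false -- project-wide option (lakefile weak.linter.dupNamespace); `Summit.Langlands.Langlands` is the mandated namespace

namespace Summit.Langlands.Langlands.Theorems

/-- **Assembly of route TorsionAvatarReduction** (stmt-Langlands-28547): `TA → AL → FRAME⁗ → Langlands`.  Proof: unfold `Assembly` and apply
the route's deciding theorem `Theses.TorsionAvatarReduction.closes`. -/
theorem torsionAvatarReduction_assembly_proof :
    Summit.Langlands.Langlands.Theses.TorsionAvatarReduction.Assembly := by
  unfold Summit.Langlands.Langlands.Theses.TorsionAvatarReduction.Assembly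
  exact Summit.Langlands.Langlands.Theses.TorsionAvatarReduction.closes

end Summit.Langlands.Langlands.Theorems
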